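import Literature.LinearAlgebra.Matrix.CrossProduct
import Mathlib.LinearAlgebra.Matrix.DotProduct
import Mathlib.Data.Real.Basic
import HarnessLib

/-!
# The generalized cross product: Gram identity `|cross A|² = det(A Aᵀ)` and rotation equivariance

Sequel of `CrossProduct.lean` (`cross A`, the vector of signed maximal minors of a
`d × (d + 1)` matrix, `α ⬝ cross A = det [A; α]`). Two further folklore properties of the
"vector product of `d` vectors in `ℝ^{d+1}`" (Spivak, *Calculus on Manifolds* (1965), Ch. 4,
p. 84; the Hodge dual `⋆(v₁ ∧ ⋯ ∧ v_d)`):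

* `cross_mul_transpose_eq_of_mul_transpose_eq_one` — **equivariance under orthogonal maps**:
  for `R` with `R Rᵀ = 1`, `cross (A Rᵀ) = det R • R (cross A)` (the rows `Aᵢ ↦ R Aᵢ`; so the
  product is `SO(d+1)`-equivariant and changes sign under orientation reversal) — over any
  commutative ring;
* `cross_dotProduct_cross_eq_det` — **the Gram identity** `cross A ⬝ cross A = det (A Aᵀ)`
  (the square length of `v₁ × ⋯ × v_d` is the Gram determinant `det(⟨vᵢ, vⱼ⟩)`, i.e. the squared
  `d`-volume of the parallelepiped) — over `ℝ`, via the bordered matrix `W = [A; cross A]`: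
  `det W = |cross A|²` and `W Wᵀ = diag(A Aᵀ, |cross A|²)`.

These are the two facts about `S₁ ∧ ⋯ ∧ Sₙ` used by Aubry 2005, Lemme 18 (p. 401: "on a alors
`S₁ ∧ ⋯ ∧ Sₙ = c X_{n+1}`, où `c²` vaut `det(⟨Sᵢ, Sⱼ⟩)`", in an oriented orthonormal frame),
recorded here in matrix form for the eigenvalue pinching programme
(`Literature/Geometry/Riemannian/EigenvaluePinchingSphere*.lean`). Everything is proved; no
definitions.
-/

namespace Literature.LinearAlgebra.Matrix

open _root_.Matrix

variable {R : Type*} [CommRing R] {d : ℕ}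

/-- Right multiplication acts row-wise on a bordered matrix: `[A; α] M = [A M; α M]`. [folklore] -/
theorem snocRow_mul (A : Matrix (Fin d) (Fin (d + 1)) R) (α : Fin (d + 1) → R)
    (M : Matrix (Fin (d + 1)) (Fin (d + 1)) R) :
    snocRow A α * M = snocRow (A * M) (α ᵥ* M) := by
  ext i j
  refine Fin.lastCases ?_ (fun i => ?_) i
  · rw [Matrix.mul_apply]
    simp only [snocRow_last]
    rfl
  · rw [Matrix.mul_apply]
    simp only [snocRow_castSucc, Matrix.mul_apply]

/-- Two vectors with the same dot products against every vector are equal. [folklore] -/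
theorem eq_of_forall_dotProduct_eq {v w : Fin (d + 1) → R} (h : ∀ u, u ⬝ᵥ v = u ⬝ᵥ w) : v = w := by
  funext a
  have := h (Pi.single a 1)
  rwa [single_one_dotProduct, single_one_dotProduct] at this

/-- **Equivariance of the generalized cross product under orthogonal transformations** (over any
commutative ring): if `R Rᵀ = 1` then `cross (A Rᵀ) = det R • R (cross A)` — transforming every
row `Aᵢ ↦ R Aᵢ` transforms the cross product by `R`, up to the sign `det R = ±1` (so it is
`SO`-equivariant: the Hodge dual `⋆(v₁ ∧ ⋯ ∧ v_d)` depends only on the metric and the orientation).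
Proof: `u ⬝ cross(A Rᵀ) = det [A Rᵀ; u] = det ([A; uR] Rᵀ) = det R · (uR) ⬝ cross A
= u ⬝ (det R • R cross A)`. [folklore] -/
theorem cross_mul_transpose_eq_of_mul_transpose_eq_one (A : Matrix (Fin d) (Fin (d + 1)) R)
    (Rm : Matrix (Fin (d + 1)) (Fin (d + 1)) R) (hR : Rm * Rm.transpose = 1) :
    cross (A * Rm.transpose) = Rm.det • (Rm *ᵥ cross A) := by
  refine eq_of_forall_dotProduct_eq fun u => ?_
  have hu : (u ᵥ* Rm) ᵥ* Rm.transpose = u := by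
    rw [Matrix.vecMul_vecMul, hR, Matrix.vecMul_one]
  rw [dotProduct_cross, dotProduct_smul, dotProduct_mulVec, dotProduct_cross, smul_eq_mul]
  have hmat : snocRow (A * Rm.transpose) u = snocRow A (u ᵥ* Rm) * Rm.transpose := by
    rw [snocRow_mul, hu]
  rw [hmat, Matrix.det_mul, Matrix.det_transpose, mul_comm]

section Real

/-- **The Gram identity for the generalized cross product** (over `ℝ`):
`cross A ⬝ cross A = det (A Aᵀ)` — the squared length of `v₁ × ⋯ × v_d` is the Gram determinant
`det(⟨vᵢ, vⱼ⟩)` of the rows (Aubry 2005, p. 401: "`c²` vaut `det(⟨Sᵢ, Sⱼ⟩)`"). Proof: for the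
bordered matrix `W = [A; c]`, `c = cross A`, Laplace gives `det W = c ⬝ c`, while
`W Wᵀ = diag(A Aᵀ, c ⬝ c)` (`A c = 0`), so `(c ⬝ c)² = det(A Aᵀ)(c ⬝ c)`; if `c ⬝ c = 0` then
`c = 0`, the rows are dependent (`cross_ne_zero_iff`) and `det(A Aᵀ) = 0` as well.
[cite: Aubry2005, Lemme 18 proof (p. 401)] -/
theorem cross_dotProduct_cross_eq_det (A : Matrix (Fin d) (Fin (d + 1)) ℝ) :
    cross A ⬝ᵥ cross A = (A * A.transpose).det := by
  set c := cross A with hc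
  set W := snocRow A c with hW
  have hdetW : W.det = c ⬝ᵥ c := by rw [hW, ← dotProduct_cross]
  -- `W Wᵀ` is block diagonal
  have hAc : ∀ i, A i ⬝ᵥ c = 0 := fun i => dotProduct_row_cross A i
  have hWW : ∀ i j, (W * W.transpose) i j = W i ⬝ᵥ W j := fun i j => by
    rw [Matrix.mul_apply]; rfl
  have hlast : ∀ j : Fin d, (W * W.transpose) (Fin.last d) (Fin.castSucc j) = 0 := fun j => by
    rw [hWW, hW, snocRow_last, snocRow_castSucc, dotProduct_comm, hAc]
  have hcorner : (W * W.transpose) (Fin.last d) (Fin.last d) = c ⬝ᵥ c := by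
    rw [hWW, hW, snocRow_last]
  have hsub : (W * W.transpose).submatrix Fin.castSucc Fin.castSucc = A * A.transpose := by
    ext i j
    rw [Matrix.submatrix_apply, hWW, hW, snocRow_castSucc, snocRow_castSucc, Matrix.mul_apply]
    rfl
  -- Laplace along the last row
  have hdetWW : (W * W.transpose).det = c ⬝ᵥ c * (A * A.transpose).det := by
    rw [Matrix.det_succ_row _ (Fin.last d), Fin.sum_univ_castSucc]
    have hzero : ∀ j : Fin d, (-1 : ℝ) ^ ((Fin.last d : ℕ) + (Fin.castSucc j : ℕ)) *
        (W * W.transpose) (Fin.last d) (Fin.castSucc j) *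
        ((W * W.transpose).submatrix (Fin.last d).succAbove (Fin.castSucc j).succAbove).det = 0 :=
      fun j => by rw [hlast j, mul_zero, zero_mul]
    rw [Finset.sum_eq_zero (fun j _ => hzero j), zero_add, hcorner, Fin.succAbove_last, hsub]
    have hsign : (-1 : ℝ) ^ ((Fin.last d : ℕ) + (Fin.last d : ℕ)) = 1 := by
      rw [Fin.val_last, ← two_mul, pow_mul, neg_one_sq, one_pow]
    rw [hsign, one_mul]
  have hsq : (c ⬝ᵥ c) ^ 2 = c ⬝ᵥ c * (A * A.transpose).det := by
    rw [← hdetWW, Matrix.det_mul, Matrix.det_transpose, hdetW, sq]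
  by_cases h0 : c ⬝ᵥ c = 0
  · -- `c = 0`, rows dependent, Gram determinant zero
    have hc0 : c = 0 := dotProduct_self_eq_zero.1 h0
    have hdep : ¬ LinearIndependent ℝ (fun i => A i) := fun hli =>
      (cross_ne_zero_of_linearIndependent_rows A hli) (hc ▸ hc0)
    obtain ⟨g, hg, i, hi⟩ := Fintype.not_linearIndependent_iff.1 hdep
    have hvec : g ᵥ* A = 0 := by
      funext j
      have := congrFun hg j
      simpa [Matrix.vecMul, dotProduct, Finset.sum_apply, Pi.smul_apply, smul_eq_mul] using this
    have hgA : g ᵥ* (A * A.transpose) = 0 := by rw [← Matrix.vecMul_vecMul, hvec, Matrix.zero_vecMul]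
    have hdet0 : (A * A.transpose).det = 0 :=
      Matrix.exists_vecMul_eq_zero_iff.1 ⟨g, fun h => hi (congrFun h i), hgA⟩
    rw [h0, hdet0]
  · exact mul_left_cancel₀ h0 (by rw [← sq, hsq])

end Real

end Literature.LinearAlgebra.Matrix
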